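import Literature.NumberTheory.Sieve.SmoothZetaDecayLongRange
import Literature.NumberTheory.Sieve.SmoothZetaDecayNearAxisSaddle
import Literature.NumberTheory.LFunctions.ZetaScaleTwistedLogPrimeSum
import Literature.NumberTheory.LFunctions.MertensSecondLogPower
import Literature.NumberTheory.Sieve.SmoothZetaDecayLongRangeLemmas
import HarnessLib

/-!
# Long-range decay of `ζ(α + it, y)/ζ(α, y)` in the polylog regime, from scale-wise
# zero-freeness of `ζ` (hence under the Riemann Hypothesis)

Topic `Literature/NumberTheory/Sieve`; a PROVED file.  We discharge `FriableZetaLongRangeDecay`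
(`SmoothZetaDecayLongRange.lean`: Hildebrand–Tenenbaum, Trans. AMS 296 (1986), Lemma 8 (ii) (3.16) in
the range `3 ≤ |t| ≤ y¹²`, `(log x)^4 ≤ y ≤ exp((log x)^{1/5})`) from the scale-wise zero-freeness
hypothesis of `ZetaScaleTwistedSum.lean`

  `hZ : ∀ η > 2/3, ∀ᶠ X, ∀ s, |Im s| ≤ 3X → 1 − (log X)^{-η} ≤ Re s → ζ₁ s ≠ 0`,

which holds under RH (`ZetaScale.scaleZeroFree_of_riemannHypothesis`) and under any
Vinogradov–Korobov region for `ζ` (`ZetaScale.scaleZeroFree_of_zetaRegion`).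

Proof (op. cit. p. 276, the twisted prime number theorem replacing Lemma 6).  By
`norm_smoothZetaC_le_mul_exp_neg_decaySum`, `|ζ(α+it,y)|/ζ(α,y) ≤ e^{-W}` with
`W = Σ_{p ≤ y} p^{-α}(1 − cos(t log p)) ≥ W'/log y`, `W' = Σ_{p ≤ y} log p · p^{-α}(1 − cos(t log p)) = A − R`,
where `A = Σ_{p ≤ y} log p · p^{-α} ≥ log x − 30` (saddle-point equation) and `A ≥ ϑ(y) y^{-α} ≥ (19/20) y^{1-α}`
(prime number theorem), while `R = Σ_{p ≤ y} log p · p^{-α} cos(t log p)` splits at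
`P = exp((12 log y)^{3/4})`, the bottom of the Vinogradov–Korobov window at scale `X = y¹²`: the primes
`≤ P` give `≤ log 4 (1 + log y) P^{1-α} ≤ log 4 (1 + log y) u/20` (Chebyshev; `P^{1-α} ≤ √u` from
`y^{1-α} ≤ u³` and `(12 log y)^{3/4} ≤ log y/6`), and the primes in `(P, y]` give
`≤ y^{1-α}(2/|t| + (4 + 2 log y)/(144 log² y)) ≤ (203/300) y^{1-α} ≤ (203/285) A`
(`ZetaScale.sum_primes_log_rpow_cos_le_of_scale`).  Hence `W' ≥ log x/10`, `W ≥ u/10` (`u = log x/log y`):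

* `exists_decaySum_saddlePoint_ge_of_scale` — `W ≥ u/10` in the range, under `hZ`;
* `friableZetaLongRangeDecay_of_scaleZeroFree`, `friableZetaLongRangeDecay_of_riemannHypothesis`.

## References

* A. Hildebrand, G. Tenenbaum, Trans. AMS 296 (1986) 265–290, Lemma 8 (ii) (3.16) and its proof,
  p. 276 [HildebrandTenenbaum1986].
-/

noncomputable section

open Real Complex Filter Finset
open scoped Chebyshev

namespace Literature.NumberTheory.Sieve

open Literature.NumberTheory.LFunctions

set_option maxHeartbeats 1600000 in
/-- **The decay sum at the saddle point is `≥ u/10` for `3 ≤ |t| ≤ y¹²`**, from scale-wise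
zero-freeness of `ζ`: there is `x₀` such that for `x ≥ x₀`, `(log x)^4 ≤ y ≤ exp((log x)^{1/5})`,
`α = α(x, y)` and `3 ≤ |t| ≤ y¹²`: `0 < α` and `Σ_{p ≤ y} p^{-α}(1 − cos(t log p)) ≥ (log x/log y)/10`.
[cite: HildebrandTenenbaum1986, Lemma 8 (ii), proof of (3.16), p. 276] -/
theorem exists_decaySum_saddlePoint_ge_of_scale
    (hZ : ∀ η : ℝ, 2 / 3 < η → ∀ᶠ X : ℝ in atTop, ∀ s : ℂ, |s.im| ≤ 3 * X →
      1 - Real.log X ^ (-η) ≤ s.re → riemannZeta₁ s ≠ 0) :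
    ∃ x₀ : ℝ, ∀ (x : ℝ) (y : ℕ), x₀ ≤ x → Real.log x ^ 4 ≤ (y : ℝ) →
      Real.log (y : ℝ) ≤ Real.log x ^ (1 / 5 : ℝ) → ∀ t : ℝ, 3 ≤ |t| → |t| ≤ (y : ℝ) ^ 12 →
        0 < saddlePoint x y ∧
        Real.log x / Real.log y / 10 ≤
          ∑ p ∈ Nat.primesLE y, (p : ℝ) ^ (-saddlePoint x y) * (1 - Real.cos (t * Real.log p)) := by
  classical
  -- ### constants from the tree
  obtain ⟨x₃, h35⟩ := three_fifths_le_saddlePoint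
  obtain ⟨c_B, x_B, hc_B, hB⟩ := le_rpow_one_sub_saddlePoint
  obtain ⟨C_A, x_A, hC_A, hA⟩ := rpow_one_sub_saddlePoint_le
  obtain ⟨C_θ, hC_θ0, hϑ⟩ := Mertens.exists_abs_theta_sub_le_div_log_pow 1
  obtain ⟨X₀, hX₀⟩ := Filter.eventually_atTop.1
    (ZetaScale.sum_primes_log_rpow_cos_le_of_scale hZ (show (2 : ℝ) / 3 < 3 / 4 by norm_num))
  set ℓ₀ : ℝ := max (20 * C_θ + 20) ((72 : ℝ) ^ 4) with hℓ₀
  set u₀ : ℝ := max (max 400 (Real.exp 1 / c_B + 2)) (C_A + 1) with hu₀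
  have hu₀400 : 400 ≤ u₀ := le_trans (le_max_left _ _) (le_max_left _ _)
  have hu₀1 : 1 ≤ u₀ := by linarith only [hu₀400]
  set L₀ : ℝ := max (max (max X₀ 100) (Real.exp ℓ₀)) (u₀ ^ 2) with hL₀
  have hL₀100 : 100 ≤ L₀ := le_trans (le_trans (le_max_right _ _) (le_max_left _ _)) (le_max_left _ _)
  refine ⟨max (max (max x₃ x_B) x_A) (Real.exp L₀), fun x y hx hy4 hylog t ht3 hty => ?_⟩
  -- ### the range
  have hx₃ : x₃ ≤ x :=
    le_trans (le_trans (le_max_left _ _) (le_max_left _ _)) (le_trans (le_max_left _ _) hx)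
  have hxB : x_B ≤ x :=
    le_trans (le_trans (le_max_right _ _) (le_max_left _ _)) (le_trans (le_max_left _ _) hx)
  have hxA : x_A ≤ x := le_trans (le_max_right _ _) (le_trans (le_max_left _ _) hx)
  have hxexp : Real.exp L₀ ≤ x := le_trans (le_max_right _ _) hx
  have hx1 : 1 < x := lt_of_lt_of_le (Real.one_lt_exp_iff.2 (by linarith only [hL₀100])) hxexp
  have hx0 : 0 < x := by linarith only [hx1]
  set L : ℝ := Real.log x with hL
  have hLL₀ : L₀ ≤ L := by
    have := Real.log_le_log (Real.exp_pos _) hxexp; rwa [Real.log_exp] at this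
  have hL100 : 100 ≤ L := le_trans hL₀100 hLL₀
  have hLX₀ : X₀ ≤ L :=
    le_trans (le_trans (le_trans (le_max_left _ _) (le_max_left _ _)) (le_max_left _ _)) hLL₀
  have hLℓ₀ : Real.exp ℓ₀ ≤ L := le_trans (le_trans (le_max_right _ _) (le_max_left _ _)) hLL₀
  have hLu₀ : u₀ ^ 2 ≤ L := le_trans (le_max_right _ _) hLL₀
  have hL0 : 0 < L := by linarith only [hL100]
  -- `r = L^{1/5}`
  set r : ℝ := L ^ (1 / 5 : ℝ) with hr
  have hr0 : 0 < r := Real.rpow_pos_of_pos hL0 _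
  have hr5 : r ^ 5 = L := by
    rw [hr, ← Real.rpow_natCast, ← Real.rpow_mul hL0.le]; norm_num
  have hr1 : 1 ≤ r := by
    by_contra h; push Not at h
    have : r ^ 5 < 1 := pow_lt_one₀ hr0.le h (by norm_num)
    linarith only [this, hr5, hL100]
  have hrL : r ≤ L := by
    calc r = r * 1 := (mul_one r).symm
      _ ≤ r * r ^ 4 := mul_le_mul_of_nonneg_left (one_le_pow₀ hr1) hr0.le
      _ = L := by rw [← hr5]; ring
  set ℓ : ℝ := Real.log y with hℓ
  have hℓr : ℓ ≤ r := hylog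
  have hybig : (10 : ℝ) ^ 8 ≤ y :=
    calc (10 : ℝ) ^ 8 = 100 ^ 4 := by norm_num
      _ ≤ L ^ 4 := pow_le_pow_left₀ (by norm_num) hL100 4
      _ ≤ y := hy4
  have hy0 : (0 : ℝ) < y := by linarith only [hybig]
  have hy1 : (1 : ℝ) < y := by linarith only [hybig]
  have hy2R : (2 : ℝ) ≤ y := by linarith only [hybig]
  have hy2 : 2 ≤ y := by exact_mod_cast hy2R
  have hyL : L ≤ (y : ℝ) := by
    calc L ≤ L ^ 4 := by
          calc L = L * 1 * 1 * 1 := by ring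
            _ ≤ L * L * L * L := by gcongr <;> linarith only [hL100]
            _ = L ^ 4 := by ring
      _ ≤ y := hy4
  have hyx : (y : ℝ) ≤ x := (Real.log_le_log_iff hy0 hx0).1 (le_trans hℓr hrL)
  have hlx3 : Real.log x ^ 3 ≤ y := by
    have : L ^ 3 ≤ L ^ 4 := pow_le_pow_right₀ (by linarith only [hL100]) (by norm_num)
    linarith only [this, hy4]
  -- `ℓ ≥ 4 log L ≥ ℓ₀`
  have hlogL : ℓ₀ ≤ Real.log L := by
    have := Real.log_le_log (Real.exp_pos _) hLℓ₀; rwa [Real.log_exp] at this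
  have hℓ4 : 4 * Real.log L ≤ ℓ := by
    have := Real.log_le_log (by positivity) hy4
    rw [Real.log_pow] at this
    push_cast at this
    exact this
  have hlogL0 : 0 ≤ Real.log L := Real.log_nonneg (by linarith only [hL100])
  have hℓℓ₀ : ℓ₀ ≤ ℓ := by linarith only [hlogL, hℓ4, hlogL0]
  have hℓθ : 20 * C_θ + 20 ≤ ℓ := le_trans (le_max_left _ _) hℓℓ₀
  have hℓ72 : (72 : ℝ) ^ 4 ≤ ℓ := le_trans (le_max_right _ _) hℓℓ₀
  have hℓbig : (1000 : ℝ) ≤ ℓ := by norm_num at hℓ72; linarith only [hℓ72]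
  have hℓ0 : 0 < ℓ := by linarith only [hℓbig]
  -- `u = L/ℓ ≥ r⁴ ≥ u₀`
  set u : ℝ := L / ℓ with hu
  have huℓ : u * ℓ = L := by rw [hu]; field_simp
  have hu_r4 : r ^ 4 ≤ u := by
    rw [hu, le_div_iff₀ hℓ0]
    calc r ^ 4 * ℓ ≤ r ^ 4 * r := mul_le_mul_of_nonneg_left hℓr (by positivity)
      _ = L := by rw [← hr5]; ring
  have hu_u₀ : u₀ ≤ u := by
    have h1 : u₀ ^ 5 ≤ (r ^ 4) ^ 5 := by
      calc u₀ ^ 5 ≤ u₀ ^ 8 := pow_le_pow_right₀ hu₀1 (by norm_num)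
        _ = (u₀ ^ 2) ^ 4 := by ring
        _ ≤ L ^ 4 := pow_le_pow_left₀ (by positivity) hLu₀ 4
        _ = (r ^ 4) ^ 5 := by rw [← hr5]; ring
    exact le_trans (le_of_pow_le_pow_left₀ (by norm_num) (by positivity) h1) hu_r4
  have hu400 : 400 ≤ u := le_trans hu₀400 hu_u₀
  have hu_cB : Real.exp 1 / c_B + 2 ≤ u := le_trans (le_trans (le_max_right _ _) (le_max_left _ _)) hu_u₀
  have hu_CA : C_A + 1 ≤ u := le_trans (le_max_right _ _) hu_u₀
  have hu2 : 2 ≤ u := by linarith only [hu400]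
  have hu0 : 0 < u := by linarith only [hu400]
  have hu_small : u ≤ L / 1000 := by
    rw [hu]; exact div_le_div_of_nonneg_left hL0.le (by norm_num) hℓbig
  -- ### `α`, `β = 1 - α`
  set α : ℝ := saddlePoint x y with hαdef
  have hα35 : 3 / 5 ≤ α := h35 x y hx₃ hlx3 hyx
  have hα0 : 0 < α := by linarith only [hα35]
  have hlogu1 : 1 ≤ Real.log (u + 1) := by
    rw [Real.le_log_iff_exp_le (by linarith only [hu2])]
    have := Real.exp_one_lt_d9; linarith only [this, hu2]
  have hlogu_le : Real.log (u + 1) ≤ u := by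
    have := Real.log_le_sub_one_of_pos (show 0 < u + 1 by linarith only [hu0]); linarith only [this]
  have hyβ_lo : c_B * (u * Real.log (u + 1)) ≤ (y : ℝ) ^ (1 - α) := hB x y hxB hlx3 hyx
  have hyβ_hi : (y : ℝ) ^ (1 - α) ≤ C_A * (u * Real.log (u + 1)) := hA x y hxA hlx3 hyx
  have hyβ_e : Real.exp 1 ≤ (y : ℝ) ^ (1 - α) := by
    have h1 : Real.exp 1 / c_B ≤ u := by linarith only [hu_cB]
    rw [div_le_iff₀ hc_B] at h1
    calc Real.exp 1 ≤ u * c_B := h1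
      _ = c_B * (u * 1) := by ring
      _ ≤ c_B * (u * Real.log (u + 1)) := by gcongr
      _ ≤ _ := hyβ_lo
  have hyβ_u3 : (y : ℝ) ^ (1 - α) ≤ u ^ 3 := by
    have hCA : C_A ≤ u := by linarith only [hu_CA]
    calc (y : ℝ) ^ (1 - α) ≤ C_A * (u * Real.log (u + 1)) := hyβ_hi
      _ ≤ u * (u * u) := by gcongr
      _ = u ^ 3 := by ring
  have hlogyβ : Real.log ((y : ℝ) ^ (1 - α)) = (1 - α) * ℓ := by rw [Real.log_rpow hy0, hℓ]
  have hβℓ1 : 1 ≤ (1 - α) * ℓ := by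
    have := Real.log_le_log (Real.exp_pos 1) hyβ_e
    rwa [Real.log_exp, hlogyβ] at this
  have hβℓ3 : (1 - α) * ℓ ≤ 3 * Real.log u := by
    have := Real.log_le_log (by positivity) hyβ_u3
    rw [hlogyβ, Real.log_pow] at this
    push_cast at this
    exact this
  have hβ0 : 0 < 1 - α := by
    by_contra h; push Not at h
    have : (1 - α) * ℓ ≤ 0 := mul_nonpos_of_nonpos_of_nonneg h hℓ0.le
    linarith only [this, hβℓ1]
  have hα1 : α < 1 := by linarith only [hβ0]
  have hinvβ : 1 / (1 - α) ≤ ℓ := by rw [div_le_iff₀ hβ0]; linarith only [hβℓ1]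
  -- ### `A = Σ_{p ≤ y} log p · p^{-α}`
  set A : ℝ := ∑ p ∈ Nat.primesLE y, Real.log p * (p : ℝ) ^ (-α) with hAdef
  have hA1 : L - 30 ≤ A := by
    have h1 := saddleSum_saddlePoint hx1 hy2
    have h2 := saddleSum_le_sum_primesLE_log_mul_rpow_add hα35 hy2
    rw [← hαdef] at h1; rw [← hAdef] at h2; linarith only [h1, h2]
  -- `y^{1-α} ≤ (20/19) A` from `ϑ(y) ≥ (19/20) y`
  have hθy : (19 / 20 : ℝ) * y ≤ θ (y : ℝ) := by
    have h1 := hϑ (y : ℝ) hy2R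
    rw [pow_one] at h1
    have h2 : (y : ℝ) - C_θ * y / ℓ ≤ θ (y : ℝ) := by
      have := (abs_le.1 h1).1; rw [hℓ]; linarith only [this]
    have h3 : C_θ * y / ℓ ≤ y / 20 := by
      rw [div_le_iff₀ hℓ0]
      have : C_θ * 20 ≤ ℓ := by linarith only [hℓθ]
      nlinarith only [this, hy0, hC_θ0]
    linarith only [h2, h3]
  have hyβA : (y : ℝ) ^ (1 - α) ≤ 20 / 19 * A := by
    have h1 := theta_mul_rpow_neg_le_sum_primesLE_log_mul_rpow hα0.le y
    rw [← hAdef] at h1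
    have h2 : (y : ℝ) ^ (1 - α) = y * (y : ℝ) ^ (-α) := by
      rw [Real.rpow_sub hy0, Real.rpow_one, Real.rpow_neg hy0.le, div_eq_mul_inv]
    have h3 : 0 ≤ (y : ℝ) ^ (-α) := Real.rpow_nonneg hy0.le _
    rw [h2]
    nlinarith only [hθy, h1, h3]
  -- ### the window `P = exp((12ℓ)^{3/4})`, `n = ⌊P⌋`
  set E : ℝ := (12 * ℓ) ^ (3 / 4 : ℝ) with hE
  have hEℓ : E ≤ ℓ / 6 := twelve_mul_rpow_three_quarters_le_div_six hℓ72
  have hE8 : 8 ≤ E := eight_le_twelve_mul_rpow_three_quarters (by linarith only [hℓbig])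
  set P : ℝ := Real.exp E with hP
  have hP9 : 9 ≤ P := by have := Real.add_one_le_exp E; linarith only [this, hE8]
  have hPy : P ≤ y := by
    calc P ≤ Real.exp ℓ := Real.exp_le_exp.2 (by linarith only [hEℓ, hℓ0])
      _ = y := by rw [hℓ, Real.exp_log hy0]
  set n : ℕ := ⌊P⌋₊ with hn
  have hnP : (n : ℝ) ≤ P := Nat.floor_le (by linarith only [hP9])
  have hPn : P < n + 1 := Nat.lt_floor_add_one P
  have hn2R : (2 : ℝ) ≤ n := by linarith only [hPn, hP9]
  have hn2 : 2 ≤ n := by exact_mod_cast hn2R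
  have hn0 : (0 : ℝ) < n := by linarith only [hn2R]
  have hnhalf : P / 2 ≤ n := by linarith only [hPn, hP9]
  have hny : n ≤ y := by exact_mod_cast hnP.trans hPy
  -- `n^{1-α} ≤ P^{1-α} ≤ √u ≤ u/20`
  have hnβ : (n : ℝ) ^ (1 - α) ≤ u / 20 := by
    have h1 : (n : ℝ) ^ (1 - α) ≤ P ^ (1 - α) := Real.rpow_le_rpow hn0.le hnP hβ0.le
    have h2 : P ^ (1 - α) = Real.exp (E * (1 - α)) := by rw [hP, ← Real.exp_mul]
    have h3a : E * (1 - α) ≤ ℓ / 6 * (1 - α) := mul_le_mul_of_nonneg_right hEℓ hβ0.le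
    have h3 : E * (1 - α) ≤ Real.log u * (1 / 2) := by nlinarith only [h3a, hβℓ3]
    have h4 : Real.exp (Real.log u * (1 / 2)) = Real.sqrt u := by
      rw [Real.sqrt_eq_rpow, Real.rpow_def_of_pos hu0]
    have h5 : (20 : ℝ) ≤ Real.sqrt u := by
      rw [show (20 : ℝ) = Real.sqrt (20 ^ 2) by rw [Real.sqrt_sq (by norm_num)]]
      exact Real.sqrt_le_sqrt (by linarith only [hu400])
    have h6 : Real.sqrt u * Real.sqrt u = u := Real.mul_self_sqrt hu0.le
    calc (n : ℝ) ^ (1 - α) ≤ P ^ (1 - α) := h1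
      _ = Real.exp (E * (1 - α)) := h2
      _ ≤ Real.exp (Real.log u * (1 / 2)) := Real.exp_le_exp.2 h3
      _ = Real.sqrt u := h4
      _ ≤ u / 20 := by
          rw [le_div_iff₀ (by norm_num : (0 : ℝ) < 20)]
          nlinarith only [h5, h6, Real.sqrt_nonneg u]
  -- ### the far primes `(n, y]`
  set X : ℝ := (y : ℝ) ^ 12 with hX
  have hyX : (y : ℝ) ≤ X := by rw [hX]; exact le_self_pow₀ hy1.le (by norm_num)
  have hXX₀ : X₀ ≤ X := by linarith only [hLX₀, hyL, hyX]
  have hlogX : Real.log X = 12 * ℓ := by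
    rw [hX, Real.log_pow, hℓ]; push_cast; ring
  have ht1 : 1 ≤ |t| := by linarith only [ht3]
  have hnwin : Real.exp (Real.log X ^ (3 / 4 : ℝ)) / 2 ≤ n := by rw [hlogX]; exact hnhalf
  have hfar := hX₀ X hXX₀ t ht1 hty α hα0 hα1 n y hnwin hny hyX
  have hcoef : 2 / |t| + Real.log X ^ (-(2 : ℝ)) * (4 + 2 / (1 - α)) ≤ 203 / 300 := by
    have h1 : 2 / |t| ≤ 2 / 3 := div_le_div_of_nonneg_left (by norm_num) (by norm_num) ht3
    have h2 : Real.log X ^ (-(2 : ℝ)) = 1 / (144 * ℓ ^ 2) := by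
      rw [hlogX, Real.rpow_neg (by positivity), Real.rpow_two]; ring
    have h3 : 4 + 2 / (1 - α) ≤ 4 + 2 * ℓ := by
      have : 2 / (1 - α) = 2 * (1 / (1 - α)) := by ring
      rw [this]; linarith only [hinvβ]
    have h4 : Real.log X ^ (-(2 : ℝ)) * (4 + 2 / (1 - α)) ≤ 1 / 100 := by
      rw [h2]
      calc 1 / (144 * ℓ ^ 2) * (4 + 2 / (1 - α)) ≤ 1 / (144 * ℓ ^ 2) * (4 + 2 * ℓ) :=
            mul_le_mul_of_nonneg_left h3 (by positivity)
        _ ≤ 1 / 100 := by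
            rw [div_mul_eq_mul_div, one_mul, div_le_div_iff₀ (by positivity) (by norm_num)]
            nlinarith only [hℓbig]
    linarith only [h1, h4]
  have hRbig : ∑ p ∈ (Finset.Ioc n y).filter Nat.Prime,
      Real.log p * (p : ℝ) ^ (-α) * Real.cos (t * Real.log p) ≤ 203 / 285 * A := by
    have hyβ0 : 0 ≤ (y : ℝ) ^ (1 - α) := Real.rpow_nonneg hy0.le _
    calc _ ≤ (y : ℝ) ^ (1 - α) * (2 / |t| + Real.log X ^ (-(2 : ℝ)) * (4 + 2 / (1 - α))) := hfar
      _ ≤ (y : ℝ) ^ (1 - α) * (203 / 300) := mul_le_mul_of_nonneg_left hcoef hyβ0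
      _ ≤ (20 / 19 * A) * (203 / 300) := mul_le_mul_of_nonneg_right hyβA (by norm_num)
      _ = 203 / 285 * A := by ring
  -- ### the near primes `≤ n`
  have hRsmall : ∑ p ∈ Nat.primesLE n, Real.log p * (p : ℝ) ^ (-α) * Real.cos (t * Real.log p) ≤
      1.3863 * ((u / 20) * (1 + ℓ)) := by
    have h1 : ∑ p ∈ Nat.primesLE n, Real.log p * (p : ℝ) ^ (-α) * Real.cos (t * Real.log p) ≤
        ∑ p ∈ Nat.primesLE n, Real.log p * (p : ℝ) ^ (-α) := by
      refine Finset.sum_le_sum fun p hp => ?_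
      have hpp := (Nat.mem_primesLE.1 hp).2
      have hterm : 0 ≤ Real.log p * (p : ℝ) ^ (-α) :=
        mul_nonneg (Real.log_nonneg (by exact_mod_cast hpp.one_lt.le)) (Real.rpow_nonneg (Nat.cast_nonneg p) _)
      calc _ ≤ Real.log p * (p : ℝ) ^ (-α) * 1 := mul_le_mul_of_nonneg_left (Real.cos_le_one _) hterm
        _ = _ := mul_one _
    have h2 := sum_primesLE_log_mul_rpow_le hα0.le hn2
    have h3 := integral_rpow_neg_le_of_lt_one hα1 hn2
    have hn1σ : 0 ≤ (n : ℝ) ^ (1 - α) := Real.rpow_nonneg hn0.le _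
    have h4 : (n : ℝ) ^ (1 - α) + α * ∫ t in (2 : ℝ)..n, t ^ (-α) ≤ (n : ℝ) ^ (1 - α) * (1 + ℓ) := by
      have h5 : α * ∫ t in (2 : ℝ)..n, t ^ (-α) ≤ (n : ℝ) ^ (1 - α) * ℓ := by
        calc α * ∫ t in (2 : ℝ)..n, t ^ (-α) ≤ 1 * ((n : ℝ) ^ (1 - α) / (1 - α)) :=
              mul_le_mul hα1.le h3 (integral_rpow_neg_nonneg α hn2) zero_le_one
          _ = (n : ℝ) ^ (1 - α) * (1 / (1 - α)) := by ring
          _ ≤ (n : ℝ) ^ (1 - α) * ℓ := mul_le_mul_of_nonneg_left hinvβ hn1σ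
      linarith only [h5]
    have hl4 := log_four_le
    have hl40 : 0 ≤ Real.log 4 := Real.log_nonneg (by norm_num)
    calc _ ≤ ∑ p ∈ Nat.primesLE n, Real.log p * (p : ℝ) ^ (-α) := h1
      _ ≤ Real.log 4 * ((n : ℝ) ^ (1 - α) + α * ∫ t in (2 : ℝ)..n, t ^ (-α)) := h2
      _ ≤ Real.log 4 * ((n : ℝ) ^ (1 - α) * (1 + ℓ)) := mul_le_mul_of_nonneg_left h4 hl40
      _ ≤ 1.3863 * ((u / 20) * (1 + ℓ)) := by
          apply mul_le_mul hl4 _ (by positivity) (by norm_num)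
          exact mul_le_mul_of_nonneg_right hnβ (by linarith only [hℓ0])
  -- ### assembling `W' = A − R ≥ L/10`
  have hsplit : ∑ p ∈ Nat.primesLE y, Real.log p * (p : ℝ) ^ (-α) * Real.cos (t * Real.log p) =
      ∑ p ∈ Nat.primesLE n, Real.log p * (p : ℝ) ^ (-α) * Real.cos (t * Real.log p) +
        ∑ p ∈ (Finset.Ioc n y).filter Nat.Prime,
          Real.log p * (p : ℝ) ^ (-α) * Real.cos (t * Real.log p) := by
    rw [primesLE_eq_primesLE_union_filter_Ioc hny, Finset.sum_union (disjoint_primesLE_filter_Ioc n y)]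
  have hW' : L / 10 ≤
      ∑ p ∈ Nat.primesLE y, Real.log p * (p : ℝ) ^ (-α) * (1 - Real.cos (t * Real.log p)) := by
    have h1 : ∑ p ∈ Nat.primesLE y, Real.log p * (p : ℝ) ^ (-α) * (1 - Real.cos (t * Real.log p)) =
        A - ∑ p ∈ Nat.primesLE y, Real.log p * (p : ℝ) ^ (-α) * Real.cos (t * Real.log p) := by
      rw [hAdef, ← Finset.sum_sub_distrib]
      refine Finset.sum_congr rfl fun p _ => ?_
      ring
    rw [h1, hsplit]
    have h2 : (u / 20) * (1 + ℓ) = (u + L) / 20 := by rw [← huℓ]; ring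
    rw [h2] at hRsmall
    linarith only [hRsmall, hRbig, hA1, hu_small, hL100]
  -- ### `W ≥ W'/log y`
  refine ⟨hα0, ?_⟩
  have hW : ∑ p ∈ Nat.primesLE y, Real.log p * (p : ℝ) ^ (-α) * (1 - Real.cos (t * Real.log p)) ≤
      ℓ * ∑ p ∈ Nat.primesLE y, (p : ℝ) ^ (-α) * (1 - Real.cos (t * Real.log p)) := by
    rw [Finset.mul_sum]
    refine Finset.sum_le_sum fun p hp => ?_
    obtain ⟨hpy, hpp⟩ := Nat.mem_primesLE.1 hp
    have hp0 : (0 : ℝ) < p := by exact_mod_cast hpp.pos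
    have hlogp : Real.log p ≤ ℓ := Real.log_le_log hp0 (by exact_mod_cast hpy)
    have hterm : 0 ≤ (p : ℝ) ^ (-α) * (1 - Real.cos (t * Real.log p)) :=
      mul_nonneg (Real.rpow_nonneg hp0.le _) (by linarith only [Real.cos_le_one (t * Real.log p)])
    rw [mul_assoc]
    exact mul_le_mul_of_nonneg_right hlogp hterm
  rw [show Real.log x / ℓ / 10 = (L / 10) / ℓ by rw [hL]; ring, div_le_iff₀ hℓ0]
  calc L / 10 ≤ _ := hW'
    _ ≤ _ := hW
    _ = _ := mul_comm _ _

/-- **Long-range decay of the friable zeta ratio from scale-wise zero-freeness of `ζ`**: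
`FriableZetaLongRangeDecay` (with `c = 1/10`) under the hypothesis `hZ` of `ZetaScaleTwistedSum.lean`.
[cite: HildebrandTenenbaum1986, Lemma 8 (ii) (3.16)] -/
theorem friableZetaLongRangeDecay_of_scaleZeroFree
    (hZ : ∀ η : ℝ, 2 / 3 < η → ∀ᶠ X : ℝ in atTop, ∀ s : ℂ, |s.im| ≤ 3 * X →
      1 - Real.log X ^ (-η) ≤ s.re → riemannZeta₁ s ≠ 0) :
    FriableZetaLongRangeDecay := by
  obtain ⟨x₀, h⟩ := exists_decaySum_saddlePoint_ge_of_scale hZ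
  refine ⟨1 / 10, by norm_num, x₀, fun x y hx hy hℓ t ht3 hty => ?_⟩
  obtain ⟨hα0, hW⟩ := h x y hx hy hℓ t ht3 hty
  have hζ := norm_smoothZetaC_le_mul_exp_neg_decaySum hα0 t y
  have hζ0 := smoothZeta_pos (y := y) hα0
  rw [div_le_iff₀ hζ0]
  refine hζ.trans ?_
  rw [mul_comm]
  refine mul_le_mul_of_nonneg_right (Real.exp_le_exp.2 ?_) hζ0.le
  linarith only [hW]

/-- **Long-range decay of the friable zeta ratio under the Riemann Hypothesis**: RH gives the
scale-wise zero-freeness (`ZetaScale.scaleZeroFree_of_riemannHypothesis`).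
[cite: HildebrandTenenbaum1986, Lemma 8 (ii) (3.16)] -/
theorem friableZetaLongRangeDecay_of_riemannHypothesis (h : RiemannHypothesis) :
    FriableZetaLongRangeDecay :=
  friableZetaLongRangeDecay_of_scaleZeroFree (ZetaScale.scaleZeroFree_of_riemannHypothesis h)

end Literature.NumberTheory.Sieve

end
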